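import Summits.BirchSwinnertonDyer.BirchSwinnertonDyer.Theorems.ClassRecordThreeCartanOnePlaceDegreeLawAtThreeGramMatrix
import Mathlib.Analysis.SpecialFunctions.Elliptic.Weierstrass
import HarnessLib

/-!
# Crux NUM `CartanOnePlaceDegreeLawAtThree` (item 24801) — (GRAM) from the discreteness of the period lattice

Seat `bsd-stepL-tam3-p1` g30 (LEAD of 24801; `--supports` 24801). ASSEMBLY: the statement `(GRAM)`
`Cruxes.CartanOnePlaceDegreeLawAtThree.Petarea.PeterssonGram` VERBATIM follows from ONE remaining input, the
DISCRETENESS of the period lattice — «`𝕃(u, Λ_L)` has integer coordinates `e : 𝕃 ≃ ℤ^dd` whose coordinate vectors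
are `ℝ`-linearly independent in `S₂` of the cover» (where Eichler–Shimura injectivity for `S₂(Γ̄(q))` enters; not
proved here) — by `exists_isHypFundamentalDomain_principalLevel` (the domain `Fq`), the (GRAM) finiteness
hypothesis read on `Fq`, and `peterssonGram_of_linearIndependent` (Gram matrix: positive definite, invariant,
quadratic form = component-summed Petersson norm). With (COVOL) `covolumeIndex`, (SHEET) `sheetUnfolding` and
(AREA) `areaFormula` this leaves the print conjunct (PET) of the crux resting on that single discreteness statement.
Nothing about NUM or any curve; BSD is proved for no curve. [cite: ShimuraIATAF1971, §3.5 and Thm. 8.4] [cite: CaiShuTian2014, §1.2 p. 5]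
-/

set_option linter.dupNamespace false
set_option autoImplicit false

noncomputable section

open scoped Classical Pointwise MatrixGroups ModularForm ENNReal UpperHalfPlane
open MeasureTheory Matrix

namespace Summit.BirchSwinnertonDyer.BirchSwinnertonDyer.Theorems.CartanCover

open Literature.NumberTheory.Automorphic Literature.NumberTheory.EllipticCurves.ModularForms
open Summit.BirchSwinnertonDyer.BirchSwinnertonDyer.Theorems

/-- **(GRAM) from discreteness.** If for every cover reduction `R` (`q ∈ C`), period pair `L` and induced vector `u`
the period lattice `𝕃(u, Λ_L)` has integer coordinates with `ℝ`-independent coordinate vectors, then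
`Petarea.PeterssonGram` holds (conclusion stated verbatim). -/
theorem peterssonGram_of_discrete
    (hdisc : ∀ {D M : ℕ} {C : Finset ℕ} {X : CartanLevelCurveData D M C} {q : ℕ} [Fact q.Prime]
      (R : CoverReduction X q), q ∈ C → ∀ (L : PeriodPair) (u : R.IndCuspForm),
        ∃ (dd : ℕ) (e : R.periodLattice L.lattice u ≃ₗ[ℤ] (Fin dd → ℤ)),
          LinearIndependent ℝ fun i : Fin dd =>
            ((e.symm (Pi.single i 1) : R.periodLattice L.lattice u) : R.IndCuspForm)) :
    ∀ {D M : ℕ} {C : Finset ℕ} {X : CartanLevelCurveData D M C} {q : ℕ} [Fact q.Prime] (R : CoverReduction X q), q ∈ C →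
      ∀ (L : PeriodPair) (u : R.IndCuspForm),
        (∀ F' : Set ℍ, IsHypFundamentalDomain (principalLevel X q) F' →
          ∀ g : GL (Fin 2) (ZMod q), ∫⁻ τ in F', ENNReal.ofReal (‖(u.1 g) τ‖ ^ 2 * τ.im ^ 2) ≠ ⊤) →
        ∃ Fq : Set ℍ, IsHypFundamentalDomain (principalLevel X q) Fq ∧
          ∃ (dd : ℕ) (e : R.periodLattice L.lattice u ≃ₗ[ℤ] (Fin dd → ℤ)) (S : Matrix (Fin dd) (Fin dd) ℝ),
            S.PosDef ∧
            (∀ g', Matrix.transpose (CartanSchurForm.realMat (coordRep e (R.latticeRep L.lattice u)) g') * S *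
                CartanSchurForm.realMat (coordRep e (R.latticeRep L.lattice u)) g' = S) ∧
            ∀ v : R.periodLattice L.lattice u,
              (fun i => ((e v) i : ℝ)) ⬝ᵥ (S *ᵥ fun i => ((e v) i : ℝ)) =
                (∑ g : GL (Fin 2) (ZMod q), ∫⁻ τ in Fq, ENNReal.ofReal (‖((v : R.IndCuspForm).1 g) τ‖ ^ 2 * τ.im ^ 2)).toReal := by
  intro D M C X q _ R hq L u hfin
  obtain ⟨Fq, hFq⟩ := exists_isHypFundamentalDomain_principalLevel X q
  have hu : R.FinitePet Fq u := fun g => lt_top_iff_ne_top.mpr (hfin Fq hFq g)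
  obtain ⟨dd, e, hind⟩ := hdisc R hq L u
  obtain ⟨S, hS, hinv, hnorm⟩ := R.peterssonGram_of_linearIndependent L.lattice u hFq hu e hind
  exact ⟨Fq, hFq, dd, e, S, hS, hinv, hnorm⟩

end Summit.BirchSwinnertonDyer.BirchSwinnertonDyer.Theorems.CartanCover

end
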